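import Summits.ValiantsHypothesis.ValiantsHypothesis.Theorems.BarrierLeverAnchoredDoorHitsLowerPairsUDoor

/-!
# Support item `AnchoredDoorHitsLowerPairs` (stmt-ValiantsHypothesis-22510), line `anchored-peeling`:
# THE PENDANT CALCULUS — «the pendant-extended three-matrix door is totally nonsingular modulo the obvious obstructions» (conjecture GPC)

Helper file (`--supports stmt-ValiantsHypothesis-22510`; cell valiant-natproofs, rung V4, 𝒟-side door (c); registered line
`Cruxes/AnchoredDoorHitsLowerPairs/Lines/anchored_peeling.lean` v30; prover seat val-np-p1 gen 29; memo HOME/val-np-p1/g29/MEMO-udoor-valnp1-g29.md §8).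
Closes NO item.

WHAT. The member of 𝔄₁ made of a generic three-matrix CORE (`uDoorPoint`, file `…UDoor`) on core vertices together with BARE PENDANT anchors: a pendant
column vertex `e` (datum `pa e = some a`) carries exactly one anchor `1 + x_a y_e` (weight 1, no tails) to a core row vertex `a`, a pendant row vertex `b`
(`pd b = some d`) exactly one anchor `1 + x_b y_d` to a core column vertex `d`; no tail ever touches a pendant vertex: `gpcPoint θ Φ Ψ pa pd`. Its layout entry
at `(U, W)` is `[signature conditions] · M_core[U₀ ∖ a(W_E), W₀ ∖ d(U_B)]` (`U = U₀ ⊔ U_B` core/pendant parts), so two OBVIOUS obstructions to the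
nonsingularity of a square block `(u, w)` — for ARBITRARY injective face families, not only lower ones — are: two rows (or two columns) with the same
signature `(U₀, d(U_B))` (identical rows), and the absence of a perfect matching inside the structural support `GPCSupported` (the entry vanishes unless
`a` is injective on `W_E` with `a(W_E) ⊆ U₀`, `d` injective on `U_B` with `d(U_B) ⊆ W₀`, and the two reduced core faces are both empty or both nonempty).
**CONJECTURE GPC (`Stmt.conjGPC`): these are the ONLY obstructions.** Evidence (memo §8.1, §8.7; exact mod 2³¹−1): 0 exceptions in either direction on
> 300 000 instances — lower pairs with k ≤ 4 pendant columns at 4+4, k ≤ 3 at 4+5/5+4, k = 2 at 5+5 (kit j331075), mixed pendant rows+columns at 4+4, and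
RANDOM (non-lower) families at h = 3, 4 (kit j331248 / j331305 extend this). Special cases BY NAME: no pendants = `Stmt.conjUDoorTNS` (`conjUDoorTNS_of_conjGPC`,
the matching is the identity or the transposition pairing the empty row with the empty column), hence `Stmt.conjUDoor`, TU1, `stub_vertexStep` and the
route decl (`anchoredDoorHitsLowerPairs_of_conjGPC`); one pendant column on a lower pair = the pendant step `Stmt.conjPendantStep` (file `…PendantStep`;
there the star inequality `|St a₀| ≥ |St e₀|` is exactly Hall's condition). WHY REGISTER A STRONGER STATEMENT: the class «generic core + bare pendants,
arbitrary families» is closed under the transfer identities of memo §8.3/§8.6 (a core vertex becomes a pendant after extracting a tail monomial), which is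
the intended induction; U1 alone is not closed under them.

WHAT THIS IS NOT: GPC is NOT proved here; nothing on crux stmt-ValiantsHypothesis-14610 or on `VP` versus `VNP`.
-/

set_option linter.dupNamespace false

namespace Summit.ValiantsHypothesis.ValiantsHypothesis.Theorems.BarrierLever.AnchoredPeeling

open Finset MvPolynomial

noncomputable section

variable {h : ℕ}

/-- **The pendant-calculus point of 𝔄₁.** `pa e = some a`: `e` is a pendant COLUMN vertex attached to the row vertex `a` by the bare anchor `(a | e)`;
`pd b = some d`: `b` is a pendant ROW vertex attached to the column vertex `d` by the bare anchor `(b | d)`; vertices with `none` are CORE vertices and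
carry the three-matrix door `(θ, Φ, Ψ)` among themselves. No tail touches a pendant vertex or a pendant anchor. (Values on non-singleton anchors:
the corresponding sums; irrelevant at profile 1.) -/
def gpcPoint (θ Φ Ψ : Fin h → Fin h → ℂ) (pa pd : Fin h → Option (Fin h)) : Param h → ℂ
  | Sum.inl β => ∑ x ∈ β.1, ∑ y ∈ β.2,
      (match pa y, pd x with
        | some a, none => if x = a then 1 else 0
        | none, some d => if y = d then 1 else 0
        | none, none => θ x y
        | some _, some _ => 0)
  | Sum.inr (Sum.inl (β, b)) =>
      if (∀ x ∈ β.1, pd x = none) then ∑ y ∈ β.2, (match pa y, pd b with | none, none => Φ y b | _, _ => 0) else 0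
  | Sum.inr (Sum.inr (β, e)) =>
      if (∀ y ∈ β.2, pa y = none) then ∑ x ∈ β.1, (match pd x, pa e with | none, none => Ψ x e | _, _ => 0) else 0

/-- The pendant part of a row face: its pendant row vertices. -/
def pendRows (pd : Fin h → Option (Fin h)) (U : Finset (Fin h)) : Finset (Fin h) := U.filter fun b => (pd b).isSome
/-- The core part of a row face. -/
def coreRows (pd : Fin h → Option (Fin h)) (U : Finset (Fin h)) : Finset (Fin h) := U.filter fun b => ¬ (pd b).isSome
/-- The pendant part of a column face. -/
def pendCols (pa : Fin h → Option (Fin h)) (W : Finset (Fin h)) : Finset (Fin h) := W.filter fun e => (pa e).isSome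
/-- The core part of a column face. -/
def coreCols (pa : Fin h → Option (Fin h)) (W : Finset (Fin h)) : Finset (Fin h) := W.filter fun e => ¬ (pa e).isSome

/-- The attachment maps as total functions (identity on core vertices). -/
def attach (p : Fin h → Option (Fin h)) : Fin h → Fin h := fun v => (p v).getD v

/-- **Structural support of the pendant layout:** the entry at `(U, W)` can be nonzero only if the attachment maps are injective on the pendant parts,
land inside the core parts of the other face, and the two reduced core faces are simultaneously empty or nonempty. -/
def GPCSupported (pa pd : Fin h → Option (Fin h)) (U W : Finset (Fin h)) : Prop :=
  Set.InjOn (attach pd) ↑(pendRows pd U) ∧ Set.InjOn (attach pa) ↑(pendCols pa W) ∧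
    (pendCols pa W).image (attach pa) ⊆ coreRows pd U ∧ (pendRows pd U).image (attach pd) ⊆ coreCols pa W ∧
    (coreRows pd U \ (pendCols pa W).image (attach pa) = ∅ ↔ coreCols pa W \ (pendRows pd U).image (attach pd) = ∅)

/-- **The criterion:** distinct rows have distinct signatures `(core part, attached image of the pendant part)`, likewise columns, and the structural
support admits a perfect matching. -/
def GPCCriterion {r : ℕ} (pa pd : Fin h → Option (Fin h)) (u w : Fin r → Finset (Fin h)) : Prop :=
  (∀ i i', coreRows pd (u i) = coreRows pd (u i') → (pendRows pd (u i)).image (attach pd) = (pendRows pd (u i')).image (attach pd) → i = i') ∧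
  (∀ j j', coreCols pa (w j) = coreCols pa (w j') → (pendCols pa (w j)).image (attach pa) = (pendCols pa (w j')).image (attach pa) → j = j') ∧
  ∃ σ : Equiv.Perm (Fin r), ∀ i, GPCSupported pa pd (u i) (w (σ i))

/-- **CONJECTURE GPC (the pendant calculus; offered node text).** For all `h`, `r`, all injective families `u`, `w` of faces (NOT necessarily lower),
all pendant data `pa`, `pd` attaching pendant vertices to CORE vertices of the other side, the criterion `GPCCriterion` implies that some three-matrix
core `(θ, Φ, Ψ)` makes the profile-1 symbolic minor nonzero at `gpcPoint θ Φ Ψ pa pd`. -/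
def Stmt.conjGPC : Prop :=
  ∀ (h r : ℕ) (u w : Fin r → Finset (Fin h)), Function.Injective u → Function.Injective w →
    ∀ (pa pd : Fin h → Option (Fin h)),
      (∀ e a, pa e = some a → pd a = none) → (∀ b d, pd b = some d → pa d = none) →
      GPCCriterion pa pd u w →
      ∃ θ Φ Ψ : Fin h → Fin h → ℂ, MvPolynomial.eval (gpcPoint θ Φ Ψ pa pd) (symbolicDet 1 h r u w) ≠ 0

/-! ## No pendants: GPC specialises to total nonsingularity of the three-matrix door -/

/-- With no pendants the pendant-calculus point is the three-matrix point. -/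
theorem gpcPoint_none (θ Φ Ψ : Fin h → Fin h → ℂ) :
    gpcPoint θ Φ Ψ (fun _ => none) (fun _ => none) = uDoorPoint θ Φ Ψ := by
  funext p
  rcases p with β | ⟨β, b⟩ | ⟨β, e⟩
  · simp only [gpcPoint, uDoorPoint]
  · simp [gpcPoint, uDoorPoint]
  · simp [gpcPoint, uDoorPoint]

/-- With no pendants every face is its own core part and has empty pendant part. -/
theorem pendRows_none (U : Finset (Fin h)) : pendRows (fun _ => (none : Option (Fin h))) U = ∅ := by
  simp [pendRows]

/-- With no pendants the core part of a row face is the face itself. -/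
theorem coreRows_none (U : Finset (Fin h)) : coreRows (fun _ => (none : Option (Fin h))) U = U := by
  simp [coreRows]

/-- With no pendants a column face has empty pendant part. -/
theorem pendCols_none (W : Finset (Fin h)) : pendCols (fun _ => (none : Option (Fin h))) W = ∅ := by
  simp [pendCols]

/-- With no pendants the core part of a column face is the face itself. -/
theorem coreCols_none (W : Finset (Fin h)) : coreCols (fun _ => (none : Option (Fin h))) W = W := by
  simp [coreCols]

/-- With no pendants the structural support is «both empty or both nonempty». -/
theorem gpcSupported_none (U W : Finset (Fin h)) :
    GPCSupported (fun _ => none) (fun _ => none) U W ↔ (U = ∅ ↔ W = ∅) := by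
  simp [GPCSupported, pendRows_none, coreRows_none, pendCols_none, coreCols_none]

/-- With no pendants, matched emptiness of injective families is exactly the criterion's matching (identity, or the transposition pairing the empty
row with the empty column). -/
theorem gpcCriterion_none {r : ℕ} (u w : Fin r → Finset (Fin h)) (hu : Function.Injective u) (hw : Function.Injective w)
    (hm : (∃ i, u i = ∅) ↔ (∃ j, w j = ∅)) : GPCCriterion (fun _ => none) (fun _ => none) u w := by
  refine ⟨fun i i' hc _ => hu (by simpa [coreRows_none] using hc), fun j j' hc _ => hw (by simpa [coreCols_none] using hc), ?_⟩
  simp only [gpcSupported_none]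
  by_cases hex : ∃ i, u i = ∅
  · obtain ⟨i₀, hi₀⟩ := hex
    obtain ⟨j₀, hj₀⟩ := hm.mp ⟨i₀, hi₀⟩
    refine ⟨Equiv.swap i₀ j₀, fun i => ?_⟩
    by_cases h1 : i = i₀
    · subst h1
      rw [Equiv.swap_apply_left]
      exact ⟨fun _ => hj₀, fun _ => hi₀⟩
    · by_cases h2 : i = j₀
      · subst h2
        rw [Equiv.swap_apply_right]
        constructor
        · intro hu0; exact absurd (hu (hu0.trans hi₀.symm)) h1
        · intro hw0; exact absurd (hw (hw0.trans hj₀.symm)) (Ne.symm h1)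
      · rw [Equiv.swap_apply_of_ne_of_ne h1 h2]
        constructor
        · intro hu0; exact absurd (hu (hu0.trans hi₀.symm)) h1
        · intro hw0; exact absurd (hw (hw0.trans hj₀.symm)) h2
  · refine ⟨Equiv.refl _, fun i => ?_⟩
    rw [Equiv.refl_apply]
    constructor
    · intro hu0; exact absurd ⟨i, hu0⟩ hex
    · intro hw0; exact absurd (hm.mpr ⟨i, hw0⟩) hex

/-- **GPC ⟹ TNS** (`Stmt.conjUDoorTNS`: total nonsingularity of the three-matrix door on families with matched emptiness). -/
theorem conjUDoorTNS_of_conjGPC (hG : Stmt.conjGPC) : Stmt.conjUDoorTNS := by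
  intro h r u w hu hw hm
  obtain ⟨θ, Φ, Ψ, hne⟩ := hG h r u w hu hw (fun _ => none) (fun _ => none) (fun _ _ h0 => by simp at h0) (fun _ _ h0 => by simp at h0)
    (gpcCriterion_none u w hu hw hm)
  exact ⟨θ, Φ, Ψ, by rwa [gpcPoint_none] at hne⟩

/-- **GPC ⟹ the registered stub `stub_vertexStep`.** -/
theorem stub_vertexStep_of_conjGPC (hG : Stmt.conjGPC) : Stmt.stub_vertexStep :=
  stub_vertexStep_of_conjUDoorTNS (conjUDoorTNS_of_conjGPC hG)

/-- **Composition BY NAME: `Stmt.conjGPC → AnchoredDoorHitsLowerPairs`.** -/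
theorem anchoredDoorHitsLowerPairs_of_conjGPC (hG : Stmt.conjGPC) :
    Summit.ValiantsHypothesis.ValiantsHypothesis.Theses.BarrierLever.AnchoredDoorHitsLowerPairs :=
  anchoredDoorHitsLowerPairs_of_conjUDoorTNS (conjUDoorTNS_of_conjGPC hG)

end

end Summit.ValiantsHypothesis.ValiantsHypothesis.Theorems.BarrierLever.AnchoredPeeling
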